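import Summits.CriticalPhenomena.PercolationContinuityZ3.Theorems.PercNearOneGluingNoHeavyLowerTailTypedReductions
import HarnessLib

/-!
# `NoHeavyLowerTail` (stmt-CriticalPhenomena-4575) — the one-cut bound WITH CONSTANTS already gives the crux

`Theorems.noHeavyLowerTail_of_oneCut` reduces the crux to the sharp one-cut bound
`P(1 ≤ N < E N/2) ≤ t` (`t` = any bound on the pairwise disconnection probabilities).  Sharpness is not
needed: this file records the reduction from the weaker, more robust engine

  `∃ C, ∃ ρ₀ > 0:  P(1 ≤ N ∧ N < ρ₀ · E N) ≤ C · t`   for every finite weighted graph, relay set and `t ≥ 0`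
  bounding all pairwise disconnection probabilities among distinct relays

(`noHeavyLowerTail_of_oneCut_const`, with `δ := min (ρ₀ ε) (ε / max C 1) / 2`).  So a prover of the one-cut
line may lose any absolute constant and any fixed fraction of the mean; only UNIFORMITY in `|A|` and in
the graph matters.  (The rungs `|A| ≤ 4` are theorems with `C = 1`, `ρ₀ = 1/2`:
`Theorems.oneCut_card_le_four`.)  Bookkeeping only.
-/

noncomputable section

namespace Summit.CriticalPhenomena.PercolationContinuityZ3.Theorems

open MeasureTheory Set Literature.Probability.LatticeModels Literature.Probability.Percolation
open Summit.CriticalPhenomena.PercolationContinuityZ3.Theses.PercNearOneGluing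
open scoped Classical BigOperators

/-- **One-cut bound with constants ⇒ `NoHeavyLowerTail`.**  If for some `C` and some `ρ₀ > 0` every finite
weighted graph satisfies `P(1 ≤ N ∧ N < ρ₀·E N) ≤ C·t` whenever all pairwise disconnection probabilities
among distinct relays are `≤ t` (`t ≥ 0`), then the crux holds, with `δ := min (ρ₀ ε) (ε / max C 1) / 2`. -/
theorem noHeavyLowerTail_of_oneCut_const :
    (∃ (C ρ₀ : ℝ), 0 < ρ₀ ∧ ∀ (n : ℕ) (w : Sym2 (Fin n) → unitInterval) (A : Finset (Fin n)) (o : Fin n) (t : ℝ), 0 ≤ t → (∀ a ∈ A, ∀ a' ∈ A, a ≠ a' → (Literature.Probability.LatticeModels.prodBernoulli w).real (Literature.Probability.Percolation.openConn a a')ᶜ ≤ t) → (Literature.Probability.LatticeModels.prodBernoulli w).real {ω : Literature.Probability.Percolation.BondConfig (Fin n) | 1 ≤ (A.filter fun a => ω ∈ Literature.Probability.Percolation.openConn o a).card ∧ ((A.filter fun a => ω ∈ Literature.Probability.Percolation.openConn o a).card : ℝ) < ρ₀ * (∑ a ∈ A, (Literature.Probability.LatticeModels.prodBernoulli w).real (Literature.Probability.Percolation.openConn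 o a))} ≤ C * t) →
    Summit.CriticalPhenomena.PercolationContinuityZ3.Theses.PercNearOneGluing.NoHeavyLowerTail := by
  rintro ⟨C, ρ₀, hρ₀, hcut⟩ ε hε
  set C' : ℝ := max C 1 with hC'def
  have hC'1 : 1 ≤ C' := le_max_right _ _
  have hC'0 : 0 < C' := lt_of_lt_of_le one_pos hC'1
  have hCC' : C ≤ C' := le_max_left _ _
  set δ : ℝ := min (ρ₀ * ε) (ε / C') / 2 with hδdef
  have hmin_pos : 0 < min (ρ₀ * ε) (ε / C') := lt_min (mul_pos hρ₀ hε) (div_pos hε hC'0)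
  have hδ : 0 < δ := by rw [hδdef]; linarith
  have hδ1 : δ ≤ ρ₀ * ε / 2 := by
    rw [hδdef]; linarith [min_le_left (ρ₀ * ε) (ε / C')]
  have hδ2 : δ ≤ ε / C' / 2 := by
    rw [hδdef]; linarith [min_le_right (ρ₀ * ε) (ε / C')]
  refine ⟨δ, hδ, ?_⟩
  intro n w A o _hU hpair
  set μ := prodBernoulli w with hμ
  have ht : ∀ a ∈ A, ∀ a' ∈ A, a ≠ a' → μ.real (openConn a a')ᶜ ≤ δ := by
    intro a ha a' ha' _
    rw [probReal_compl_eq_one_sub (measurableSet_openConn_holds a a')]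
    linarith [hpair a ha a' ha']
  have key := hcut n w A o δ hδ.le ht
  have hEN : 0 ≤ ∑ a ∈ A, μ.real (openConn o a) := Finset.sum_nonneg fun a _ => measureReal_nonneg
  -- the crux event (threshold `δ·EN/ε`) lies inside the engine event (threshold `ρ₀·EN`)
  have hsub : {ω : BondConfig (Fin n) | 1 ≤ (A.filter fun a => ω ∈ openConn o a).card ∧
        ((A.filter fun a => ω ∈ openConn o a).card : ℝ) <
          δ * (∑ a ∈ A, μ.real (openConn o a)) / ε} ⊆
      {ω : BondConfig (Fin n) | 1 ≤ (A.filter fun a => ω ∈ openConn o a).card ∧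
        ((A.filter fun a => ω ∈ openConn o a).card : ℝ) <
          ρ₀ * (∑ a ∈ A, μ.real (openConn o a))} := by
    rintro ω ⟨h1, h2⟩
    refine ⟨h1, lt_of_lt_of_le h2 ?_⟩
    have hratio : δ / ε ≤ ρ₀ := by
      rw [div_le_iff₀ hε]; nlinarith
    calc δ * (∑ a ∈ A, μ.real (openConn o a)) / ε
        = (δ / ε) * (∑ a ∈ A, μ.real (openConn o a)) := by ring
      _ ≤ ρ₀ * (∑ a ∈ A, μ.real (openConn o a)) := mul_le_mul_of_nonneg_right hratio hEN
  calc μ.real {ω : BondConfig (Fin n) | 1 ≤ (A.filter fun a => ω ∈ openConn o a).card ∧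
          ((A.filter fun a => ω ∈ openConn o a).card : ℝ) <
            δ * (∑ a ∈ A, μ.real (openConn o a)) / ε}
      ≤ μ.real {ω : BondConfig (Fin n) | 1 ≤ (A.filter fun a => ω ∈ openConn o a).card ∧
          ((A.filter fun a => ω ∈ openConn o a).card : ℝ) <
            ρ₀ * (∑ a ∈ A, μ.real (openConn o a))} := measureReal_mono hsub
    _ ≤ C * δ := key
    _ ≤ C' * δ := mul_le_mul_of_nonneg_right hCC' hδ.le
    _ ≤ ε / 2 := by
        have : C' * (ε / C' / 2) = ε / 2 := by field_simp
        calc C' * δ ≤ C' * (ε / C' / 2) := mul_le_mul_of_nonneg_left hδ2 hC'0.le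
          _ = ε / 2 := this
    _ < ε := by linarith

end Summit.CriticalPhenomena.PercolationContinuityZ3.Theorems

end
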